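import Literature.Combinatorics.Optimization.PsdMinimalPolytopes
import HarnessLib

/-!
# The degree-four vertex lemma and the Euler count behind the classification of psd-minimal
# `3`-polytopes (Gouveia–Robinson–Thomas 2013, Lemma 4.9 and Proposition 4.10) — the printed
# computations, PROVED

Source: J. Gouveia, R. Z. Robinson, R. R. Thomas, *Polytopes of minimum positive semidefinite rank*,
Discrete Comput. Geom. 50 (2013) 679–699 = arXiv:1205.5306 [GouveiaRobinsonThomas2013], §4.2 (held
text `paper:arxiv-1205.5306`, chunks p12–p13). The tree's `PsdMinimalPolytopes.lean` proves GRT's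
Prop. 2.6, Thm. 3.5, Thm. 4.3, Thm. 4.7 and lists "the `ℝ³` classification (Thm. 4.8 biplanar octahedra,
Lemma 4.9, Prop. 4.10, Thms. 4.11–4.12)" as NOT typed; Thm. 4.8 and Ex. 4.5 are now PROVED in
`BiplanarOctahedraPsdRank.lean`, `NonplanarOctahedraPsdRank.lean`, `OctahedronPsdRankFive.lean`. This file
proves the two COMPUTATIONS on which the remaining classification (Lemma 4.9, Prop. 4.10 ⇒ Thm. 4.11)
rests; the face-lattice bookkeeping around them (which facets contain which vertices, Steinitz-type
uniqueness of the combinatorial types) is not typed, so Lemma 4.9 / Prop. 4.10 / Thm. 4.11 themselves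
are not asserted here.

The printed text (p12–p13, verbatim). "Let `P` be a polytope in `ℝ³` of psd rank four. By Proposition
(face psd rank), all the facets of `P` must be triangles or quadrilaterals. Further, since
`rank_psd P° = 4`, each vertex of `P` must be of degree three or four. …
**Lemma 4.9.** Let `P ⊂ ℝ³` be a three-dimensional polytope with `rank_psd P = 4`. If `p` is a vertex
of `P` of degree four, then the four facets incident to `p` must be triangles.
*Proof.* … one of the facets surrounding `p` must be a quadrilateral and `P` contains the following
structure (with `p₁,…,p₅` vertices of `P`) [figure]. Let `S_P` be a slack matrix of `P`. Then `S_P` is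
of rank four. Further, since `P` has minimum psd rank, there exists a Hadamard square root `√S_P` of
rank four. Let `M` be the `5 × 4` submatrix of `√S_P` indexed by `p, p₁, p₂, p₃, p₄` in the rows and by
the four facets incident to `p` in the columns. By scaling the columns of `√S_P` by nonzero scalars,
we may assume that `M` is of the following form, with `a,b,c,d,e` nonzero:
`[[0,0,0,0],[0,1,0,1],[0,0,1,a],[1,0,b,0],[c,d,e,0]]`.
The four rows of `√S_P` and `S_P` corresponding to the first four rows of `M` are linearly independent
by the structure of `M`. Hence, we can write the row of `√S_P` and `S_P` corresponding to the fifth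
row of `M` as a linear combination of the other four. Thus, we can write the fifth row of `M` and `M²`
as a linear combination of the first four. This results in two necessary equations: `d + ae = abc`
and `d² + a²e² = (abc)²`, which implies that `ade = 0`, a contradiction. □
**Proposition 4.10.** A polytope in `ℝ³` of psd rank four has the combinatorial type of a simplex,
quadrilateral pyramid, bisimplex, triangular prism, octahedron, or cube. *Proof.* Let `P` be a
polytope in `ℝ³` of psd rank four with `v` vertices, `e` edges, and `f` facets. Let `v_t` and `v_q`
denote the number of vertices of degree three and four in `P`, and let `f_t` and `f_q` denote the
number of triangular and quadrangular facets of `P`. By double counting edges, `2e = 3f_t + 4f_q`,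
and by considering `P°`, we also see that `2e = 3v_t + 4v_q`. Now using Euler's formula,
`v − e + f = 2`, it is easy to deduce that `v_t` and `f_t` are even and that `v_t + f_t = 8`. Hence, we
only need to consider polytopes where `(v_t,f_t)` equals `(0,8)`, `(2,6)`, `(4,4)`, `(6,2)`, or
`(8,0)`. …"

What is PROVED here.

| printed claim | Lean | status |
|---|---|---|
| the shape of `M`: rows `p,p₁,…,p₄`, the four facet columns at `p`, zeros as displayed, the displayed `1`s and `a, d, e` nonzero (before the printed column scaling; `b, c` are not needed) | `GrtDegreeFourPattern` | DEFINED (a `Prop`-valued structure on any real matrix) |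
| "The four rows … corresponding to the first four rows of `M` are linearly independent by the structure of `M`. Hence, we can write the … fifth row … as a linear combination": for ANY real matrix of rank `≤ 4` with the pattern and a nonzero row `p`, the printed relation — unscaled: `e·x·a·w = c·b·x·a − d·y·z·w` (printed `x=y=z=w=1`: `d + ae = abc`) | `GrtDegreeFourPattern.rel_of_rank_le_four` | PROVED |
| "`d + ae = abc` and `d² + a²e² = (abc)²` … implies `ade = 0`, a contradiction": a matrix of rank `≤ 4` with the pattern and `S_p ≠ 0` has NO Hadamard square root of rank `≤ 4` | `GrtDegreeFourPattern.false_of_sq_eq`, **`GrtDegreeFourPattern.not_hasHadamardSqrtOfRankLE_four`** | PROVED (sign-free, scaling-free) |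
| hence (GRT Thm. 3.5, the tree's `GouveiaRobinsonThomas2013_thm35`) a `3`-polytope whose slack matrix contains the pattern is not psd-minimal: `rank_psd S_P ≥ 5` | **`GouveiaRobinsonThomas2013_lemma49_slack`** | PROVED (for `V`/`H`-described `3`-polytopes with vertex rows and facet columns) |
| Prop. 4.10's count: `2e = 3f_t + 4f_q = 3v_t + 4v_q`, `v − e + f = 2` ⇒ `v_t, f_t` even, `v_t + f_t = 8`, `(v_t,f_t) ∈ {(0,8),(2,6),(4,4),(6,2),(8,0)}` | `GouveiaRobinsonThomas2013_prop410_count` | PROVED |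

How the algebra is done here. No column scaling and no choice of signs: for a real matrix `X` of rank
`≤ 4` carrying the pattern, the five rows `p,p₁,…,p₄` are linearly dependent; in a dependence
`Σ μ_t X_{p_t} = 0` the columns `c₁, c₂, c₄` and the nonzero row `p` force `μ₄ ≠ 0`, and eliminating
`μ₁, μ₂, μ₃` through the columns gives `e·xaw = cb·xa − dy·zw` (entries named as in
`GrtDegreeFourPattern`). Applied to a square root `N` (`N ∘ N = S`) and to `S` itself this gives
`(exaw)² = (cbxa − dyzw)²` and `(exaw)² = (cbxa)² − (dyzw)²`, whence `dyzw·(dyzw − cbxa) = 0`,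
`dyzw = cbxa` (all of `d,y,z,w ≠ 0`), `exaw = 0`, contradicting `e, x, a, w ≠ 0` — the printed
"`ade = 0`".
-/

noncomputable section

open Matrix Finset
open scoped MatrixOrder

namespace Literature.Combinatorics.Optimization

/-! ### The pattern of the `5 × 4` matrix `M` -/

/-- **The shape of GRT's matrix `M`** (Lemma 4.9, p12), for a real matrix `S` with rows `p₀` (the
degree-four vertex `p`), `p₁, p₂, p₃, p₄` and columns `c₁,…,c₄` (the four facets at `p`):
`[[0,0,0,0],[0,x,0,y],[0,0,z,a],[w,0,b,0],[c,d,e,0]]` with `x, y, z, a, w, d, e ≠ 0` (printed after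
scaling the columns: `x = y = z = w = 1` and "`a,b,c,d,e` nonzero"; the entries `b = S p₃ c₃` and
`c = S p₄ c₁` are unconstrained here). [cite: GouveiaRobinsonThomas2013, Lemma 4.9 proof (p12)] -/
structure GrtDegreeFourPattern {ι κ : Type*} (S : Matrix ι κ ℝ) (p₀ p₁ p₂ p₃ p₄ : ι)
    (c₁ c₂ c₃ c₄ : κ) : Prop where
  h01 : S p₀ c₁ = 0
  h02 : S p₀ c₂ = 0
  h03 : S p₀ c₃ = 0
  h04 : S p₀ c₄ = 0
  h11 : S p₁ c₁ = 0
  h12 : S p₁ c₂ ≠ 0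
  h13 : S p₁ c₃ = 0
  h14 : S p₁ c₄ ≠ 0
  h21 : S p₂ c₁ = 0
  h22 : S p₂ c₂ = 0
  h23 : S p₂ c₃ ≠ 0
  h24 : S p₂ c₄ ≠ 0
  h31 : S p₃ c₁ ≠ 0
  h32 : S p₃ c₂ = 0
  h34 : S p₃ c₄ = 0
  h42 : S p₄ c₂ ≠ 0
  h43 : S p₄ c₃ ≠ 0
  h44 : S p₄ c₄ = 0

namespace GrtDegreeFourPattern

variable {ι κ : Type*} {S N : Matrix ι κ ℝ} {p₀ p₁ p₂ p₃ p₄ : ι} {c₁ c₂ c₃ c₄ : κ}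

/-- The pattern passes to Hadamard square roots (`N_{ij}² = S_{ij}`: same zero set).
[cite: GouveiaRobinsonThomas2013, Lemma 4.9 proof (p12–p13: "`M` and `M²`")] -/
theorem of_sq_eq (h : GrtDegreeFourPattern S p₀ p₁ p₂ p₃ p₄ c₁ c₂ c₃ c₄)
    (hN : ∀ i j, N i j ^ 2 = S i j) : GrtDegreeFourPattern N p₀ p₁ p₂ p₃ p₄ c₁ c₂ c₃ c₄ := by
  have z : ∀ {i j}, S i j = 0 → N i j = 0 := fun {i j} h0 => by
    have := hN i j; rw [h0] at this; exact (pow_eq_zero_iff two_ne_zero).mp this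
  have nz : ∀ {i j}, S i j ≠ 0 → N i j ≠ 0 := fun {i j} h0 hn => by
    apply h0; rw [← hN i j, hn]; ring
  exact ⟨z h.h01, z h.h02, z h.h03, z h.h04, z h.h11, nz h.h12, z h.h13, nz h.h14, z h.h21, z h.h22,
    nz h.h23, nz h.h24, nz h.h31, z h.h32, z h.h34, nz h.h42, nz h.h43, z h.h44⟩

/-- **"we can write the fifth row of `M` … as a linear combination of the first four. This results
in [the] necessary equation `d + ae = abc`"** — unscaled and for ANY real matrix `S` of rank `≤ 4`
with the pattern and `S_p ≠ 0`: with `x = S p₁ c₂, y = S p₁ c₄, z = S p₂ c₃, a = S p₂ c₄, w = S p₃ c₁,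
b = S p₃ c₃, c = S p₄ c₁, d = S p₄ c₂, e = S p₄ c₃`, `e·x·a·w = c·b·x·a − d·y·z·w`. (The five rows
are dependent since `rank S ≤ 4`; the columns `c₁, c₂, c₄` and `S_p ≠ 0` show that the coefficient
of row `p₄` in a dependence is nonzero — "the four rows … are linearly independent by the structure
of `M`".) [cite: GouveiaRobinsonThomas2013, Lemma 4.9 proof (p12–p13)] -/
theorem rel_of_rank_le_four [Fintype κ] (h : GrtDegreeFourPattern S p₀ p₁ p₂ p₃ p₄ c₁ c₂ c₃ c₄)
    (h0 : S p₀ ≠ 0) (hr : S.rank ≤ 4) :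
    S p₄ c₃ * S p₁ c₂ * S p₂ c₄ * S p₃ c₁ =
      S p₄ c₁ * S p₃ c₃ * S p₁ c₂ * S p₂ c₄ - S p₄ c₂ * S p₁ c₄ * S p₂ c₃ * S p₃ c₁ := by
  classical
  let P : Fin 5 → ι := ![p₀, p₁, p₂, p₃, p₄]
  -- the five rows are dependent
  have hdep : ¬ LinearIndependent ℝ (fun t => S (P t)) := by
    intro hli
    have h5 : (S.submatrix P id).rank = 5 := by
      simpa using LinearIndependent.rank_matrix (M := S.submatrix P id) (by exact hli)
    have hle := Matrix.rank_submatrix_le S P (id : κ → κ)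
    omega
  obtain ⟨g, hg, t₀, ht₀⟩ := Fintype.not_linearIndependent_iff.mp hdep
  have hcol : ∀ c, g 0 * S p₀ c + g 1 * S p₁ c + g 2 * S p₂ c + g 3 * S p₃ c + g 4 * S p₄ c = 0 := by
    intro c
    have := congrFun hg c
    simpa [Fin.sum_univ_five, P, add_assoc] using this
  have e1 := hcol c₁
  have e2 := hcol c₂
  have e3 := hcol c₃
  have e4 := hcol c₄
  rw [h.h01, h.h11, h.h21] at e1
  rw [h.h02, h.h22, h.h32] at e2
  rw [h.h03, h.h13] at e3
  rw [h.h04, h.h34, h.h44] at e4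
  simp only [mul_zero, zero_add, add_zero] at e1 e2 e3 e4
  -- `e1 : g 3 * w + g 4 * c = 0`, `e2 : g 1 * x + g 4 * d = 0`,
  -- `e3 : g 2 * z + g 3 * b + g 4 * e = 0`, `e4 : g 1 * y + g 2 * a = 0`
  have hg4 : g 4 ≠ 0 := by
    intro h4
    have h3 : g 3 = 0 := by
      rw [h4, zero_mul, add_zero] at e1
      exact (mul_eq_zero.mp e1).resolve_right h.h31
    have h1 : g 1 = 0 := by
      rw [h4, zero_mul, add_zero] at e2
      exact (mul_eq_zero.mp e2).resolve_right h.h12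
    have h2 : g 2 = 0 := by
      rw [h1, zero_mul, zero_add] at e4
      exact (mul_eq_zero.mp e4).resolve_right h.h24
    have hg0 : g 0 = 0 := by
      by_contra hg0
      apply h0
      funext c
      have := hcol c
      rw [h1, h2, h3, h4] at this
      simp only [zero_mul, add_zero] at this
      exact (mul_eq_zero.mp this).resolve_left hg0
    have hall : ∀ t, g t = 0 := by
      intro t
      fin_cases t
      · exact hg0
      · exact h1
      · exact h2
      · exact h3
      · exact h4
    exact ht₀ (hall t₀)
  have key : g 4 * (S p₄ c₃ * S p₁ c₂ * S p₂ c₄ * S p₃ c₁ -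
      (S p₄ c₁ * S p₃ c₃ * S p₁ c₂ * S p₂ c₄ - S p₄ c₂ * S p₁ c₄ * S p₂ c₃ * S p₃ c₁)) = 0 := by
    linear_combination (S p₁ c₂ * S p₂ c₄ * S p₃ c₁) * e3
      - (S p₃ c₃ * S p₁ c₂ * S p₂ c₄) * e1 - (S p₂ c₃ * S p₁ c₂ * S p₃ c₁) * e4
      + (S p₁ c₄ * S p₂ c₃ * S p₃ c₁) * e2
  exact sub_eq_zero.mp ((mul_eq_zero.mp key).resolve_left hg4)

/-- **"`d + ae = abc` and `d² + a²e² = (abc)²`, which implies that `ade = 0`, a contradiction"**: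
a real matrix `S` of rank `≤ 4` with the pattern and `S_p ≠ 0` has no Hadamard square root `N`
(`N_{ij}² = S_{ij}`, any signs) of rank `≤ 4`. [cite: GouveiaRobinsonThomas2013, Lemma 4.9 proof (p13)] -/
theorem false_of_sq_eq [Fintype κ] (h : GrtDegreeFourPattern S p₀ p₁ p₂ p₃ p₄ c₁ c₂ c₃ c₄)
    (h0 : S p₀ ≠ 0) (hS : S.rank ≤ 4) (hN : ∀ i j, N i j ^ 2 = S i j) (hNr : N.rank ≤ 4) :
    False := by
  have hpat := h.of_sq_eq hN
  have hN0 : N p₀ ≠ 0 := by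
    intro hz
    apply h0
    funext c
    rw [← hN p₀ c, hz]
    simp
  -- the two relations, in the entries of `N`
  have r1 := hpat.rel_of_rank_le_four hN0 hNr
  have r2 := h.rel_of_rank_le_four h0 hS
  simp only [← hN] at r2
  set x := N p₁ c₂
  set y := N p₁ c₄
  set z := N p₂ c₃
  set a := N p₂ c₄
  set w := N p₃ c₁
  set b := N p₃ c₃
  set c := N p₄ c₁
  set d := N p₄ c₂
  set e := N p₄ c₃
  -- `(exaw)² = (cbxa − dyzw)²` and `(exaw)² = (cbxa)² − (dyzw)²`
  have h3 : (d * y * z * w) * (d * y * z * w - c * b * x * a) = 0 := by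
    linear_combination (-(e * x * a * w + c * b * x * a - d * y * z * w) / 2) * r1 + r2 / 2
  have hdyzw : d * y * z * w ≠ 0 :=
    mul_ne_zero (mul_ne_zero (mul_ne_zero hpat.h42 hpat.h14) hpat.h23) hpat.h31
  have h4 : d * y * z * w = c * b * x * a :=
    sub_eq_zero.mp ((mul_eq_zero.mp h3).resolve_left hdyzw)
  have h5 : e * x * a * w = 0 := by linear_combination r1 - h4
  exact mul_ne_zero (mul_ne_zero (mul_ne_zero hpat.h43 hpat.h12) hpat.h24) hpat.h31 h5

/-- **GRT Lemma 4.9, matrix form**: a real matrix `S` of rank `≤ 4` containing the pattern `M`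
(with `S_p ≠ 0`) has `rank_√ S ≥ 5` — no Hadamard square root of rank `≤ 4` — so (GRT Thm. 3.5) it
is not the slack matrix of a psd-minimal `3`-polytope.
[cite: GouveiaRobinsonThomas2013, Lemma 4.9 (p12–p13)] -/
theorem not_hasHadamardSqrtOfRankLE_four [Fintype ι] [Fintype κ]
    (h : GrtDegreeFourPattern S p₀ p₁ p₂ p₃ p₄ c₁ c₂ c₃ c₄) (h0 : S p₀ ≠ 0) (hS : S.rank ≤ 4) :
    ¬ HasHadamardSqrtOfRankLE S 4 := by
  rintro ⟨N, hN, hNr⟩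
  exact h.false_of_sq_eq h0 hS hN hNr

end GrtDegreeFourPattern

/-! ### Lemma 4.9 for `V`/`H`-described `3`-polytopes -/

/-- **GRT Lemma 4.9, slack-matrix form.** Let `P = conv{x_i} = {y : a_jᵀy ≤ b_j}` be a
`3`-dimensional polytope (in some `ℝ^d`) with vertex rows (each `x_p` strictly cut out by a linear
functional) and facet columns (each inequality tight on a `2`-dimensional vertex set), and suppose its
slack matrix `S_P = (b_j − a_jᵀx_i)` contains GRT's pattern `M` on rows `p₀,…,p₄` and columns
`c₁,…,c₄` (in print: `p₀ = p` a degree-four vertex one of whose facets is a quadrilateral). Then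
`S_P` has no `S^4_+`-factorization: `rank_psd P ≥ 5`, `P` is not psd-minimal. (`S_P` has rank `4`
— the tree's `rank_pairSlackMatrix_eq_finrank_add_one` — a psd-minimal `S_P` would have a Hadamard
square root of rank `4` — GRT Thm. 3.5, the tree's `GouveiaRobinsonThomas2013_thm35` — and the row of
the vertex `p` is nonzero since a bounded `P ≠ {x_p}` has a facet missing `x_p`.)
[cite: GouveiaRobinsonThomas2013, Lemma 4.9 (p12–p13)] -/
theorem GouveiaRobinsonThomas2013_lemma49_slack {d v f : ℕ} (x : Fin v → (Fin d → ℝ))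
    (a : Fin f → (Fin d → ℝ)) (b : Fin f → ℝ)
    (hP : convexHull ℝ (Set.range x) = {y | ∀ j, a j ⬝ᵥ y ≤ b j})
    (hdim : Module.finrank ℝ (vectorSpan ℝ (Set.range x)) = 3)
    (hvert : ∀ p, ∃ c : Fin d → ℝ, ∀ i, x i ≠ x p → c ⬝ᵥ x p < c ⬝ᵥ x i)
    (hfacet : ∀ j, Module.finrank ℝ
      (vectorSpan ℝ (Set.range fun i : {i : Fin v // a j ⬝ᵥ x i = b j} => x i.1)) + 1 = 3)
    {p₀ p₁ p₂ p₃ p₄ : Fin v} {c₁ c₂ c₃ c₄ : Fin f}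
    (hpat : GrtDegreeFourPattern (Matrix.of fun i j => b j - a j ⬝ᵥ x i) p₀ p₁ p₂ p₃ p₄ c₁ c₂ c₃ c₄) :
    ¬ HasPsdFactorization (fun i j => b j - a j ⬝ᵥ x i) 4 := by
  intro hpsd
  have h35 := (GouveiaRobinsonThomas2013_thm35 x a b hP (n := 3) (by norm_num) hdim hvert hfacet).mp
    hpsd
  have hrank : (Matrix.of fun i j => b j - a j ⬝ᵥ x i).rank ≤ 4 :=
    (rank_pairSlackMatrix_eq_finrank_add_one x a b (by norm_num) hdim hP).le
  -- the row of `p₀` is nonzero: otherwise `P` contains the ray from `x p₀` through `x p₁ ≠ x p₀`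
  have h0 : (Matrix.of fun i j => b j - a j ⬝ᵥ x i) p₀ ≠ 0 := by
    intro hz
    have htight : ∀ j, a j ⬝ᵥ x p₀ = b j := fun j => by
      have := congrFun hz j
      simp only [Matrix.of_apply, Pi.zero_apply] at this
      linarith
    have hne : x p₁ ≠ x p₀ := by
      intro he
      apply hpat.h12
      simp only [Matrix.of_apply, he, htight c₂, sub_self]
    have hmemP : ∀ i, x i ∈ {y : Fin d → ℝ | ∀ j, a j ⬝ᵥ y ≤ b j} := fun i => by
      rw [← hP]; exact subset_convexHull ℝ _ (Set.mem_range_self i)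
    have hray : ∀ t : ℝ, 0 ≤ t → x p₀ + t • (x p₁ - x p₀) ∈ {y : Fin d → ℝ | ∀ j, a j ⬝ᵥ y ≤ b j} := by
      intro t ht j
      show a j ⬝ᵥ (x p₀ + t • (x p₁ - x p₀)) ≤ b j
      rw [dotProduct_add, dotProduct_smul, dotProduct_sub, htight j, smul_eq_mul]
      nlinarith [hmemP p₁ j]
    have hbdd : Bornology.IsBounded {y : Fin d → ℝ | ∀ j, a j ⬝ᵥ y ≤ b j} := by
      rw [← hP]; exact isBounded_convexHull.mpr (Set.finite_range x).isBounded
    obtain ⟨R, hR⟩ := isBounded_iff_forall_norm_le.mp hbdd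
    set u := x p₁ - x p₀ with hu
    have hun : 0 < ‖u‖ := norm_pos_iff.mpr (sub_ne_zero.mpr hne)
    have hy : ‖x p₀‖ ≤ R := hR _ (by simpa using hray 0 le_rfl)
    set t : ℝ := (R + ‖x p₀‖ + 1) / ‖u‖ with ht_def
    have ht : 0 ≤ t := div_nonneg (by linarith [norm_nonneg (x p₀)]) hun.le
    have hmem := hR _ (hray t ht)
    have htri : ‖t • u‖ ≤ ‖x p₀ + t • u‖ + ‖x p₀‖ := by
      have := norm_sub_le (x p₀ + t • u) (x p₀)
      simpa [add_sub_cancel_left] using this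
    rw [norm_smul, Real.norm_of_nonneg ht, ht_def, div_mul_cancel₀ _ hun.ne'] at htri
    linarith
  exact hpat.not_hasHadamardSqrtOfRankLE_four h0 hrank h35

/-! ### Proposition 4.10: the Euler count -/

/-- **GRT Proposition 4.10, the count** (p13): if `2e = 3f_t + 4f_q` (double counting edges over
triangular/quadrangular facets), `2e = 3v_t + 4v_q` (degrees three/four) and `v − e + f = 2` (Euler)
with `v = v_t + v_q`, `f = f_t + f_q`, then "`v_t` and `f_t` are even and … `v_t + f_t = 8`. Hence, we
only need to consider polytopes where `(v_t,f_t)` equals `(0,8), (2,6), (4,4), (6,2)`, or `(8,0)`."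
(Euler's formula and the degree/facet constraints themselves are not typed.)
[cite: GouveiaRobinsonThomas2013, Prop. 4.10 proof (p13)] -/
theorem GouveiaRobinsonThomas2013_prop410_count (vt vq ft fq e : ℕ) (hf : 2 * e = 3 * ft + 4 * fq)
    (hv : 2 * e = 3 * vt + 4 * vq) (hEuler : (vt + vq) + (ft + fq) = e + 2) :
    Even vt ∧ Even ft ∧ vt + ft = 8 ∧
      ((vt = 0 ∧ ft = 8) ∨ (vt = 2 ∧ ft = 6) ∨ (vt = 4 ∧ ft = 4) ∨ (vt = 6 ∧ ft = 2) ∨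
        (vt = 8 ∧ ft = 0)) := by
  refine ⟨⟨vt / 2, by omega⟩, ⟨ft / 2, by omega⟩, by omega, by omega⟩

end Literature.Combinatorics.Optimization
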